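import Literature.MathematicalPhysics.QuantumFieldTheory.Balaban1983to89.B7Prop10InLambdaRec
import Literature.MathematicalPhysics.QuantumFieldTheory.Balaban1983to89.B7Eq208Analytic

/-!
# `Balaban1983to89.B7Eq208AnalyticRec` — [Balaban1985Averaging] (208) p. 50: «ũ′ʲ are analytic functions of λ, and Q′_j(u₁, λ) = (1/i) log ũ′ʲ are analytic functions of λ also», AT A GENERAL
# REGULAR BACKGROUND, FOR THE RECORD (centred blocks, (0.4) average) — the record twin of the engine's `B7Eq208Analytic`

statement-level skeleton of published theorems with citation tags; proofs where landed; nothing here is a claim about the Yang–Mills mass gap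

CITATION HEADER (lean-in-tree rule).  Cell `pub-ymgap`, seat `pub-ymgap-dag-n05-e` g36 (N05-REC LEAD PEN); item R1 ([3] layer), Sect. G block, file 6: the record twin of `B7Eq208Analytic`
(lit-balaban r04 gen 5).  `--kind proof --supports stmt-QuantumFields-20541` (K0⁷; count-neutral; no definition).  Sources READ: [3] = [Balaban1985Averaging] p. 50 (207)–(208), p. 45 (178)–(179),
p. 30 (78)–(80), p. 44 (166)–(167) (`paper:balaban1985-cmp98-averaging`); [I] = [Balaban1987RG1] (0.3)–(0.4) pp. 252–253.  REUSED BY NAME: the engine's generic layer `B7Eq208Analytic.{insSite,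
analyticAt_insSite, analyticAt_site_expGauge_family, analyticAt_site_mul_family, analyticAt_site_const_family, analyticAt_R0fun_family, prod_cov_split, prod_loop_bound, siteBd_covBondBd_of207}`, this seat's
`B7Prop10GeneralRec.{prop10_generalZ', levels_of52Z}`, `B7Prop10InLambdaRec.{utilGZ_mul_uavgZ, utilGZ_eq_uavgZ_mul_inv, covBlockZ_of_covBondBd, C6_eq}`, the record's `SexpZ ∕ savgZ ∕ R0avgZ ∕ uavgZ ∕ utilGZ ∕
InLambdaZ ∕ AvgClosedZ ∕ C0Z`.

WHAT IS PROVED (sorry-free; `L = 2s + 1`, `s ≥ 1`, `d ≥ 1`).  §1 `analyticAt_SexpZ_family`, `analyticAt_savgZ_family`, `analyticAt_R0avgZ_family`; §2 `analyticAt_uavgZ_family`; §3 `analyticAt_utilGZ_family`,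
`analyticAt_mlog_utilGZ_family`; §4 the disc conditions from Prop. 10 for the record: `prodLoopZ_le` (`≤ (6/5)·8dα₄L^{j+1}η + α₃L^{j+1}η`), `prodLoopZ_lt_one`, `utilGZ_disc`; §5 ★★`eq208Z_analyticAt` ((208) for the
record, parametric), `eq208Z_analyticAt_of52`, ★`eq208Z_analyticAt_of207` (print's datum (207)), `eq208Z_analyticOnNhd_ins` ∕ `utilGZ_analyticOnNhd_ins` (the printed letter on `𝔸^S`), `eq208Z_analyticAt_line` (the form
[Balaban1985RegularSpaces] (1.124) consumes).
HONEST SCOPE.  Port of the engine's composition-of-analytic-maps argument to the record's objects; (211)–(214) for the record are the sequel; nothing of [3]∕[I] asserted beyond what is proved; `HThm4Rec`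
UNDISCHARGED; N05 discharged of record untouched; N07 not claimable; counts unmoved (typed 28∕28 · discharged 8∕28); one finite 𝕋⁴ programme at fixed ε — nothing continuum ∕ ℝ⁴ ∕ OS ∕ mass gap ∕ Clay.  No
`def`, no `instance`, no `notation`, no `sorry`.
-/

set_option autoImplicit false

noncomputable section

open scoped BigOperators
open NormedSpace Finset

namespace Literature.MathematicalPhysics.QuantumFieldTheory.Balaban1983to89.B7Eq208AnalyticRec

open B7Prop1Explicit hiding Site
open B7Prop1Explicit renaming Site → SiteZ
open MatrixLog B7Eq92Concrete
open B7Eq99Concrete (R0fun R0fun_apply R0fun_self R0fun_add)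
open B7Prop2Explicit (pdev c2')
open B7Eq170Flat (cj cj_apply val_Rc_eq_cj)
open B7Prop6Flat (norm_units_inv_sub_one_le)
open B7Prop9Flat (SiteBd C5')
open B7Prop9General (CovBondBd)
open B7Prop10Flat (one_le_C5)
open B7Prop10General (C6 C4G)
open B7Eq208Analytic (insSite analyticAt_insSite analyticAt_site_expGauge_family analyticAt_site_mul_family analyticAt_site_const_family
  analyticAt_R0fun_family prod_cov_split prod_loop_bound siteBd_covBondBd_of207)
open BlockAveragingZd (avgIterZ offZ)
open B7SectCDGaugeAveragesRec (SexpZ savgZ R0avgZ uavgZ uavgZ_zero uavgZ_succ)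
open B7SectEFLinearisationRec (utilGZ InLambdaZ)
open B7Prop2Rec (AvgClosedZ C0Z)
open B7Prop9FlatRec (savgZ_apply)
open B7Prop10GeneralRec (prop10_generalZ' levels_of52Z)
open B7Prop10InLambdaRec (utilGZ_mul_uavgZ utilGZ_eq_uavgZ_mul_inv covBlockZ_of_covBondBd)

variable {d : ℕ}

/-! ## §1 Analytic site families through the site averages (78) -/

section Family

variable {𝔸 : Type*} [NormedRing 𝔸] [NormedAlgebra ℂ 𝔸] [CompleteSpace 𝔸]
variable {E : Type*} [NormedAddCommGroup E] [NormedSpace ℂ E]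

/-- **the exponent of the site average (78)**, `S_g(y) = Σ_{x∈B(y)} L^{−d} log g(y)⁻¹g(x)`, of a sitewise-analytic unit family `g(t)` is
analytic at `t₀` wherever the block quantities `g(y)⁻¹g(x)` at `t₀` lie in the disc of the series logarithm (21) (p. 21: «both
functions are analytic functions of complex matrices X»). [cite: Balaban1985Averaging, (78) p.30, (21) p.21] -/
theorem analyticAt_SexpZ_family {g : E → SiteZ d → 𝔸ˣ} {t₀ : E}
    (hg : ∀ x, AnalyticAt ℂ (fun t => ((g t x : 𝔸ˣ) : 𝔸)) t₀ ∧ AnalyticAt ℂ (fun t => (((g t x)⁻¹ : 𝔸ˣ) : 𝔸)) t₀)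
    (L : ℕ) (y : SiteZ d)
    (hloop : ∀ r : Fin d → Fin L, ‖((((g t₀ y)⁻¹ * g t₀ (y + offZ L r) : 𝔸ˣ)) : 𝔸) - 1‖ < 1) :
    AnalyticAt ℂ (fun t => SexpZ L (g t) y) t₀ := by
  simp only [SexpZ]
  refine Finset.analyticAt_fun_sum _ fun r _ => ?_
  have hprod : AnalyticAt ℂ (fun t => ((((g t y)⁻¹ * g t (y + offZ L r) : 𝔸ˣ)) : 𝔸)) t₀ := by
    simp only [Units.val_mul]
    exact (hg y).2.fun_mul (hg _).1
  exact ((analyticAt_mlog (hloop r)).fun_comp_of_eq hprod rfl).fun_const_smul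

/-- **the site average (78)** `{g(x)}_{x∈B(y)} = g(y)·exp S_g(y)` of a sitewise-analytic unit family, and its inverse, are analytic at `t₀`
(same disc condition). [cite: Balaban1985Averaging, (78) p.30, (21) p.21] -/
theorem analyticAt_savgZ_family {g : E → SiteZ d → 𝔸ˣ} {t₀ : E}
    (hg : ∀ x, AnalyticAt ℂ (fun t => ((g t x : 𝔸ˣ) : 𝔸)) t₀ ∧ AnalyticAt ℂ (fun t => (((g t x)⁻¹ : 𝔸ˣ) : 𝔸)) t₀)
    (L : ℕ) (y : SiteZ d)
    (hloop : ∀ r : Fin d → Fin L, ‖((((g t₀ y)⁻¹ * g t₀ (y + offZ L r) : 𝔸ˣ)) : 𝔸) - 1‖ < 1) :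
    AnalyticAt ℂ (fun t => ((savgZ L (g t) y : 𝔸ˣ) : 𝔸)) t₀ ∧
      AnalyticAt ℂ (fun t => (((savgZ L (g t) y)⁻¹ : 𝔸ˣ) : 𝔸)) t₀ := by
  have hS := analyticAt_SexpZ_family hg L y hloop
  refine ⟨?_, ?_⟩
  · simp only [savgZ_apply, Units.val_mul, val_expUnit]
    exact (hg y).1.fun_mul ((exp_analytic _).fun_comp_of_eq hS rfl)
  · simp only [savgZ_apply, mul_inv_rev, Units.val_mul, val_inv_expUnit, val_expUnit]
    exact ((exp_analytic _).fun_comp_of_eq hS.neg rfl).fun_mul (hg y).2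

/-- **the twisted site average (78) `(R̄₀v)(y)` at a fixed background** of a sitewise-analytic family, and its inverse, are analytic at
`t₀` provided the block quantities `v(y)⁻¹(R_{0,y}v)(x)` at `t₀` (the expressions (167)/(180)) lie in the disc of (21).
[cite: Balaban1985Averaging, (78) p.30, (167) p.44, (180) p.46] -/
theorem analyticAt_R0avgZ_family (L : ℕ) (V₀ : SiteZ d → Fin d → 𝔸ˣ) {v : E → SiteZ d → 𝔸ˣ} {t₀ : E}
    (hv : ∀ x, AnalyticAt ℂ (fun t => ((v t x : 𝔸ˣ) : 𝔸)) t₀ ∧ AnalyticAt ℂ (fun t => (((v t x)⁻¹ : 𝔸ˣ) : 𝔸)) t₀)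
    (y : SiteZ d)
    (hloop : ∀ r : Fin d → Fin L,
      ‖((((v t₀ y)⁻¹ * Rc (hol V₀ y (treeWord (offZ L r))) (v t₀ (y + offZ L r)) : 𝔸ˣ)) : 𝔸) - 1‖ < 1) :
    AnalyticAt ℂ (fun t => ((R0avgZ L V₀ (v t) y : 𝔸ˣ) : 𝔸)) t₀ ∧
      AnalyticAt ℂ (fun t => (((R0avgZ L V₀ (v t) y)⁻¹ : 𝔸ˣ) : 𝔸)) t₀ := by
  have hg := fun x => analyticAt_R0fun_family V₀ y hv x
  have hloop' : ∀ r : Fin d → Fin L,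
      ‖((((R0fun V₀ y (v t₀) y)⁻¹ * R0fun V₀ y (v t₀) (y + offZ L r) : 𝔸ˣ)) : 𝔸) - 1‖ < 1 := fun r => by
    rw [R0fun_self, R0fun_add]; exact hloop r
  simpa only [R0avgZ] using analyticAt_savgZ_family hg L y hloop'

end Family

/-! ## §2 The tower (79)/(80) of an analytic family -/

section Tower

variable {𝔸 : Type*} [NormedRing 𝔸] [NormedAlgebra ℂ 𝔸] [CompleteSpace 𝔸]
variable {E : Type*} [NormedAddCommGroup E] [NormedSpace ℂ E]

/-- **the averages (79)/(80) `\overline{R₀u}ʲ`, `j ≤ k`, of a sitewise-analytic family `u(t)` at a fixed background are analytic at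
`t₀`** (values and inverses), provided the (167)-quantities of `u(t₀)` — `\overline{R₀u}ʲ(x_{j+1})⁻¹(R̄ʲ_{0,x_{j+1}}\overline{R₀u}ʲ)(x_j)`,
`x_j ∈ B(x_{j+1})`, `j < k`, exactly the arguments of the logarithms in the averaging step (p. 44: «we have to calculate a logarithm
of the expression in (167)») — lie in the disc `‖· − 1‖ < 1` of (21).  Induction on `j` with `analyticAt_R0avg_family` at the
averaged background `Ū₀ʲ`. [cite: Balaban1985Averaging, (79)–(80) p.30, (167) p.44, (208) p.50] -/
theorem analyticAt_uavgZ_family (L : ℕ) (U₀ : SiteZ d → Fin d → 𝔸ˣ) {u : E → SiteZ d → 𝔸ˣ} {t₀ : E}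
    (hu : ∀ x, AnalyticAt ℂ (fun t => ((u t x : 𝔸ˣ) : 𝔸)) t₀ ∧ AnalyticAt ℂ (fun t => (((u t x)⁻¹ : 𝔸ˣ) : 𝔸)) t₀)
    (k : ℕ)
    (hloop : ∀ j < k, ∀ (z : SiteZ d) (r : Fin d → Fin L),
      ‖((((uavgZ L U₀ (u t₀) j ((L : ℤ) • z))⁻¹
          * Rc (hol (avgIterZ L U₀ j) ((L : ℤ) • z) (treeWord (offZ L r)))
              (uavgZ L U₀ (u t₀) j ((L : ℤ) • z + offZ L r)) : 𝔸ˣ)) : 𝔸) - 1‖ < 1) :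
    ∀ j ≤ k, ∀ z : SiteZ d,
      AnalyticAt ℂ (fun t => ((uavgZ L U₀ (u t) j z : 𝔸ˣ) : 𝔸)) t₀ ∧
        AnalyticAt ℂ (fun t => (((uavgZ L U₀ (u t) j z)⁻¹ : 𝔸ˣ) : 𝔸)) t₀ := by
  intro j
  induction j with
  | zero => intro _ z; simpa only [uavgZ_zero] using hu z
  | succ j ih =>
    intro hjk z
    have hj : j < k := Nat.lt_of_succ_le hjk
    have h := analyticAt_R0avgZ_family L (avgIterZ L U₀ j) (v := fun t => uavgZ L U₀ (u t) j) (ih hj.le) ((L : ℤ) • z)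
      (hloop j hj z)
    simpa only [uavgZ_succ] using h

end Tower

/-! ## §3 `ũ′ʲ` and `log ũ′ʲ` via (178) -/

section Util

variable {𝔸 : Type*} [NormedRing 𝔸] [NormOneClass 𝔸] [NormedAlgebra ℂ 𝔸] [CompleteSpace 𝔸]
variable {E : Type*} [NormedAddCommGroup E] [NormedSpace ℂ E]

omit [NormOneClass 𝔸] in
/-- **«ũ′ʲ are analytic functions of λ»** in family form: for a sitewise-analytic `u′(t)`, a fixed `u₁` and a fixed background, every
`ũ′ʲ(z)[u′(t), u₁]` (`B7Prop10General.utilG`, (178)/(179)), `j ≤ k`, and its inverse are analytic at `t₀`, provided the (167)-quantities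
of the PRODUCT `u′(t₀)u₁` at the levels `j < k` lie in the disc of (21).  By (178) `ũ′ʲ = \overline{R₀u′u₁}ʲ·(\overline{R₀u₁}ʲ)⁻¹`
(`utilGZ_eq_uavgZ_mul_inv`) — the second factor does not depend on `u′` — and §2 for the product family.
[cite: Balaban1985Averaging, (208) p.50, (178)–(179) p.45] -/
theorem analyticAt_utilGZ_family (L : ℕ) (U₀ : SiteZ d → Fin d → 𝔸ˣ) {u' : E → SiteZ d → 𝔸ˣ} {t₀ : E}
    (hu' : ∀ x, AnalyticAt ℂ (fun t => ((u' t x : 𝔸ˣ) : 𝔸)) t₀ ∧ AnalyticAt ℂ (fun t => (((u' t x)⁻¹ : 𝔸ˣ) : 𝔸)) t₀)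
    (u₁ : SiteZ d → 𝔸ˣ) (k : ℕ)
    (hloop : ∀ j < k, ∀ (z : SiteZ d) (r : Fin d → Fin L),
      ‖((((uavgZ L U₀ (u' t₀ * u₁) j ((L : ℤ) • z))⁻¹
          * Rc (hol (avgIterZ L U₀ j) ((L : ℤ) • z) (treeWord (offZ L r)))
              (uavgZ L U₀ (u' t₀ * u₁) j ((L : ℤ) • z + offZ L r)) : 𝔸ˣ)) : 𝔸) - 1‖ < 1) :
    ∀ j ≤ k, ∀ z : SiteZ d,
      AnalyticAt ℂ (fun t => ((utilGZ L U₀ (u' t) u₁ j z : 𝔸ˣ) : 𝔸)) t₀ ∧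
        AnalyticAt ℂ (fun t => (((utilGZ L U₀ (u' t) u₁ j z)⁻¹ : 𝔸ˣ) : 𝔸)) t₀ := by
  intro j hj z
  have hprod := fun x => analyticAt_site_mul_family hu' (analyticAt_site_const_family u₁ t₀) x
  obtain ⟨h1, h2⟩ := analyticAt_uavgZ_family L U₀ (u := fun t => u' t * u₁) hprod k hloop j hj z
  have hfun : ∀ t, utilGZ L U₀ (u' t) u₁ j z = uavgZ L U₀ (u' t * u₁) j z * (uavgZ L U₀ u₁ j z)⁻¹ := fun t => by
    rw [utilGZ_eq_uavgZ_mul_inv]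
  refine ⟨?_, ?_⟩
  · simp only [hfun, Units.val_mul]
    exact h1.fun_mul analyticAt_const
  · simp only [hfun, mul_inv_rev, inv_inv, Units.val_mul]
    exact analyticAt_const.fun_mul h2

omit [NormOneClass 𝔸] in
/-- **«Q′_j(u₁, λ) = (1/i) log ũ′ʲ, j ≦ k, (208) are analytic functions of λ also»** in family form: under the hypotheses of
`analyticAt_utilG_family` and the disc condition `‖ũ′ʲ(z)[t₀] − 1‖ < 1` ((204): `≤ C₅α₄`), `t ↦ log ũ′ʲ(z)[u′(t), u₁]` is analytic at
`t₀`. [cite: Balaban1985Averaging, (208) p.50, (204) p.49] -/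
theorem analyticAt_mlog_utilGZ_family (L : ℕ) (U₀ : SiteZ d → Fin d → 𝔸ˣ) {u' : E → SiteZ d → 𝔸ˣ} {t₀ : E}
    (hu' : ∀ x, AnalyticAt ℂ (fun t => ((u' t x : 𝔸ˣ) : 𝔸)) t₀ ∧ AnalyticAt ℂ (fun t => (((u' t x)⁻¹ : 𝔸ˣ) : 𝔸)) t₀)
    (u₁ : SiteZ d → 𝔸ˣ) (k : ℕ)
    (hloop : ∀ j < k, ∀ (z : SiteZ d) (r : Fin d → Fin L),
      ‖((((uavgZ L U₀ (u' t₀ * u₁) j ((L : ℤ) • z))⁻¹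
          * Rc (hol (avgIterZ L U₀ j) ((L : ℤ) • z) (treeWord (offZ L r)))
              (uavgZ L U₀ (u' t₀ * u₁) j ((L : ℤ) • z + offZ L r)) : 𝔸ˣ)) : 𝔸) - 1‖ < 1)
    {j : ℕ} (hj : j ≤ k) {z : SiteZ d} (hdisc : ‖((utilGZ L U₀ (u' t₀) u₁ j z : 𝔸ˣ) : 𝔸) - 1‖ < 1) :
    AnalyticAt ℂ (fun t => mlog ((utilGZ L U₀ (u' t) u₁ j z : 𝔸ˣ) : 𝔸)) t₀ :=
  (analyticAt_mlog hdisc).fun_comp_of_eq (analyticAt_utilGZ_family L U₀ hu' u₁ k hloop j hj z).1 rfl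

end Util

/-! ## §4 The domain conditions from Proposition 10 -/

section Domain

variable {𝔸 : Type*} [NormedRing 𝔸] [NormOneClass 𝔸] [NormedAlgebra ℂ 𝔸] [CompleteSpace 𝔸]

/-- **THE (167)-QUANTITIES OF THE PRODUCT `u′u₁` UNDER PROPOSITION 10** (the (182)-split as in p05's `B7Prop10InLambda.inLambda_mul_
of_prop10_general`, kept SHARP): under the hypotheses of `B7Prop10General.prop10_general` (level backgrounds in `U1` with «`α₀` replaced
by `2α₀(Lʲη)²`», (176)/(177) for `u′`, `u₁ ∈ Λ_k(U₀, α₃)`, explicit smallness), for every `j < k`, block corner `Lz` and block point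
`Lz + r`: `‖\overline{R₀u′u₁}ʲ(Lz)⁻¹(R̄ʲ_{0,Lz}\overline{R₀u′u₁}ʲ)(Lz + r) − 1‖ ≤ (6/5)·4dα₄L^{j+1}η + α₃L^{j+1}η` — the `ũ′ʲ`-factor by
(203) summed along the tree contour (`covBlock_of_covBondBd`), the `ū₁ʲ`-factor by (167). [cite: Balaban1985Averaging, (182) p.46, (203) p.49, (167) p.44, (178) p.45] -/
theorem prodLoopZ_le {L s : ℕ} (hLs : L = 2 * s + 1) (hs1 : 1 ≤ s) (hd : 1 ≤ d) {U₀ : SiteZ d → Fin d → 𝔸ˣ} {k : ℕ} {u' u₁ : SiteZ d → 𝔸ˣ}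
    {α₀ α₃ α₄ η : ℝ}
    (hV : ∀ j < k, ∀ (x : SiteZ d) (κ : Fin d), avgIterZ L U₀ j x κ ∈ U1 𝔸)
    (h52 : ∀ j < k, ∀ (x : SiteZ d) (κ μ : Fin d), κ ≠ μ →
      ‖((hol (avgIterZ L U₀ j) x (plaqWord κ μ) : 𝔸ˣ) : 𝔸) - 1‖ ≤ 2 * α₀ * ((L : ℝ) ^ j * η) ^ 2)
    (h176 : SiteBd u' α₄) (h177 : CovBondBd U₀ u' (α₄ * η)) (hu₁ : InLambdaZ L U₀ u₁ k α₃ η)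
    (hη : 0 ≤ η) (hk : (L : ℝ) ^ k * η ≤ 1) (hα₀ : 0 ≤ α₀) (hα₃ : 0 ≤ α₃) (hα₃' : α₃ ≤ 1 / 50) (hα₄ : 0 ≤ α₄)
    (hs₁ : 10 * C6 d * α₄ ≤ 1) (hs₂ : 3000 * ((d : ℝ) + 1) * L * α₄ ≤ 1) (hs₃ : C4G d L * (α₀ + α₃ + α₄) ≤ 1)
    (hs₄ : 1024 * ((d : ℝ) + 1) * ((d : ℝ) + 4) * L ^ 2 * α₀ ≤ 1) (hs₅ : 32 * ((d : ℝ) + 1) ^ 2 * C6 d * L ^ 2 * α₀ ≤ 1)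
    (hs₆ : 16 * d * C5' d * C6 d * (L : ℝ) ^ 2 * α₀ ≤ 1)
    {j : ℕ} (hj : j < k) (z : SiteZ d) (r : Fin d → Fin L) :
    ‖((((uavgZ L U₀ (u' * u₁) j ((L : ℤ) • z))⁻¹
        * Rc (hol (avgIterZ L U₀ j) ((L : ℤ) • z) (treeWord (offZ L r)))
            (uavgZ L U₀ (u' * u₁) j ((L : ℤ) • z + offZ L r)) : 𝔸ˣ)) : 𝔸) - 1‖
      ≤ 6 / 5 * (8 * d * α₄ * ((L : ℝ) ^ (j + 1) * η)) + α₃ * ((L : ℝ) ^ (j + 1) * η) := by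
  have hL1 : 1 ≤ L := by omega
  have hLr : (1 : ℝ) ≤ L := by exact_mod_cast hL1
  have hdr : (0 : ℝ) ≤ d := Nat.cast_nonneg d
  have hP := prop10_generalZ' hLs hs1 hd hV h52 h176 h177 hu₁ hη hk hα₀ hα₃ hα₃' hα₄ hs₁ hs₂ hs₃ hs₄ hs₅ hs₆
  -- (178): `\overline{R₀u′u₁}ʲ = ũ′ʲ·\overline{R₀u₁}ʲ`
  have hfun : uavgZ L U₀ (u' * u₁) j = utilGZ L U₀ u' u₁ j * uavgZ L U₀ u₁ j := (utilGZ_mul_uavgZ L U₀ u' u₁ j).symm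
  have ht : (L : ℝ) ^ (j + 1) * η ≤ 1 :=
    le_trans (mul_le_mul_of_nonneg_right (pow_le_pow_right₀ hLr (Nat.succ_le_of_lt hj)) hη) hk
  have ht0 : 0 ≤ (L : ℝ) ^ (j + 1) * η := by positivity
  -- the `ũ′ʲ`-factor: (203) summed along the tree contour
  have h203 : CovBondBd (avgIterZ L U₀ j) (utilGZ L U₀ u' u₁ j) (2 * α₄ * ((L : ℝ) ^ j * η)) := (hP j hj.le).1
  have ht1 : (L : ℝ) ^ j * η ≤ 1 := by
    have : (L : ℝ) ^ j * η ≤ (L : ℝ) ^ (j + 1) * η := mul_le_mul_of_nonneg_right (pow_le_pow_right₀ hLr (Nat.le_succ j)) hη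
    linarith
  have hC6e := B7Prop10InLambdaRec.C6_eq (d := d)
  have h4d : 8 * (d : ℝ) * α₄ ≤ 1 := by rw [hC6e] at hs₁; nlinarith
  have ha2 : 2 * α₄ * ((L : ℝ) ^ j * η) ≤ 1 / 2 := by
    have : 2 * α₄ * ((L : ℝ) ^ j * η) ≤ 2 * α₄ * 1 := mul_le_mul_of_nonneg_left ht1 (by positivity)
    have hd1 : (1 : ℝ) ≤ d := by exact_mod_cast hd
    nlinarith
  have hsmall : 2 * ((d : ℝ) * L * (2 * α₄ * ((L : ℝ) ^ j * η))) ≤ 1 := by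
    have e : 2 * ((d : ℝ) * L * (2 * α₄ * ((L : ℝ) ^ j * η))) = 4 * d * α₄ * ((L : ℝ) ^ (j + 1) * η) := by ring
    rw [e]
    calc 4 * (d : ℝ) * α₄ * ((L : ℝ) ^ (j + 1) * η) ≤ 1 * 1 := mul_le_mul (by linarith) ht ht0 (by norm_num)
      _ = 1 := one_mul 1
  have hA := covBlockZ_of_covBondBd (hV j hj) h203 (by positivity) ha2 hsmall ((L : ℤ) • z) r
  have e : 4 * ((d : ℝ) * L * (2 * α₄ * ((L : ℝ) ^ j * η))) = 8 * d * α₄ * ((L : ℝ) ^ (j + 1) * η) := by ring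
  rw [e] at hA
  -- the `ū₁ʲ`-factor: (167) and (166) for `u₁`
  have hB : ‖((((uavgZ L U₀ u₁ j ((L : ℤ) • z))⁻¹
      * Rc (hol (avgIterZ L U₀ j) ((L : ℤ) • z) (treeWord (offZ L r)))
          (uavgZ L U₀ u₁ j ((L : ℤ) • z + offZ L r)) : 𝔸ˣ)) : 𝔸) - 1‖ ≤ α₃ * ((L : ℝ) ^ (j + 1) * η) := by
    have h := hu₁.2 j hj z r; rwa [mul_assoc] at h
  have hWy : ‖((uavgZ L U₀ u₁ j ((L : ℤ) • z) : 𝔸ˣ) : 𝔸) - 1‖ ≤ α₃ := hu₁.1 j hj.le _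
  have hb : α₃ * ((L : ℝ) ^ (j + 1) * η) ≤ 1 / 50 := by
    calc α₃ * ((L : ℝ) ^ (j + 1) * η) ≤ 1 / 50 * 1 := mul_le_mul hα₃' ht ht0 (by norm_num)
      _ = 1 / 50 := by norm_num
  rw [hfun, Pi.mul_apply, Pi.mul_apply, prod_cov_split]
  exact prod_loop_bound hWy hα₃' hA hB hb

/-- Under the hypotheses of Proposition 10 the (167)-quantities of `u′u₁` lie in the disc of (21): `≤ 1/25 < 1`
(`(6/5)·4dα₄ + α₃ ≤ 1/625 + 1/50`). [cite: Balaban1985Averaging, (182) p.46, (208) p.50] -/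
theorem prodLoopZ_lt_one {L s : ℕ} (hLs : L = 2 * s + 1) (hs1 : 1 ≤ s) (hd : 1 ≤ d) {U₀ : SiteZ d → Fin d → 𝔸ˣ} {k : ℕ} {u' u₁ : SiteZ d → 𝔸ˣ}
    {α₀ α₃ α₄ η : ℝ}
    (hV : ∀ j < k, ∀ (x : SiteZ d) (κ : Fin d), avgIterZ L U₀ j x κ ∈ U1 𝔸)
    (h52 : ∀ j < k, ∀ (x : SiteZ d) (κ μ : Fin d), κ ≠ μ →
      ‖((hol (avgIterZ L U₀ j) x (plaqWord κ μ) : 𝔸ˣ) : 𝔸) - 1‖ ≤ 2 * α₀ * ((L : ℝ) ^ j * η) ^ 2)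
    (h176 : SiteBd u' α₄) (h177 : CovBondBd U₀ u' (α₄ * η)) (hu₁ : InLambdaZ L U₀ u₁ k α₃ η)
    (hη : 0 ≤ η) (hk : (L : ℝ) ^ k * η ≤ 1) (hα₀ : 0 ≤ α₀) (hα₃ : 0 ≤ α₃) (hα₃' : α₃ ≤ 1 / 50) (hα₄ : 0 ≤ α₄)
    (hs₁ : 10 * C6 d * α₄ ≤ 1) (hs₂ : 3000 * ((d : ℝ) + 1) * L * α₄ ≤ 1) (hs₃ : C4G d L * (α₀ + α₃ + α₄) ≤ 1)
    (hs₄ : 1024 * ((d : ℝ) + 1) * ((d : ℝ) + 4) * L ^ 2 * α₀ ≤ 1) (hs₅ : 32 * ((d : ℝ) + 1) ^ 2 * C6 d * L ^ 2 * α₀ ≤ 1)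
    (hs₆ : 16 * d * C5' d * C6 d * (L : ℝ) ^ 2 * α₀ ≤ 1) :
    ∀ j < k, ∀ (z : SiteZ d) (r : Fin d → Fin L),
      ‖((((uavgZ L U₀ (u' * u₁) j ((L : ℤ) • z))⁻¹
          * Rc (hol (avgIterZ L U₀ j) ((L : ℤ) • z) (treeWord (offZ L r)))
              (uavgZ L U₀ (u' * u₁) j ((L : ℤ) • z + offZ L r)) : 𝔸ˣ)) : 𝔸) - 1‖ < 1 := by
  intro j hj z r
  have hL1 : 1 ≤ L := by omega
  have hLr : (1 : ℝ) ≤ L := by exact_mod_cast hL1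
  have hdr : (0 : ℝ) ≤ d := Nat.cast_nonneg d
  have h := prodLoopZ_le hLs hs1 hd hV h52 h176 h177 hu₁ hη hk hα₀ hα₃ hα₃' hα₄ hs₁ hs₂ hs₃ hs₄ hs₅ hs₆ hj z r
  have ht : (L : ℝ) ^ (j + 1) * η ≤ 1 :=
    le_trans (mul_le_mul_of_nonneg_right (pow_le_pow_right₀ hLr (Nat.succ_le_of_lt hj)) hη) hk
  have ht0 : 0 ≤ (L : ℝ) ^ (j + 1) * η := by positivity
  have hdα : (d : ℝ) * α₄ ≤ 1 / 3000 := by nlinarith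
  refine lt_of_le_of_lt h ?_
  nlinarith [mul_nonneg (mul_nonneg hdr hα₄) ht0, mul_nonneg hα₃ ht0]

/-- Under the hypotheses of Proposition 10, `ũ′ʲ(z)` lies in the disc of (21): (204) `‖ũ′ʲ − 1‖ ≤ C₆α₄ ≤ 1/10 < 1`.
[cite: Balaban1985Averaging, (204) p.49, (208) p.50] -/
theorem utilGZ_disc {L s : ℕ} (hLs : L = 2 * s + 1) (hs1 : 1 ≤ s) (hd : 1 ≤ d) {U₀ : SiteZ d → Fin d → 𝔸ˣ} {k : ℕ} {u' u₁ : SiteZ d → 𝔸ˣ}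
    {α₀ α₃ α₄ η : ℝ}
    (hV : ∀ j < k, ∀ (x : SiteZ d) (κ : Fin d), avgIterZ L U₀ j x κ ∈ U1 𝔸)
    (h52 : ∀ j < k, ∀ (x : SiteZ d) (κ μ : Fin d), κ ≠ μ →
      ‖((hol (avgIterZ L U₀ j) x (plaqWord κ μ) : 𝔸ˣ) : 𝔸) - 1‖ ≤ 2 * α₀ * ((L : ℝ) ^ j * η) ^ 2)
    (h176 : SiteBd u' α₄) (h177 : CovBondBd U₀ u' (α₄ * η)) (hu₁ : InLambdaZ L U₀ u₁ k α₃ η)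
    (hη : 0 ≤ η) (hk : (L : ℝ) ^ k * η ≤ 1) (hα₀ : 0 ≤ α₀) (hα₃ : 0 ≤ α₃) (hα₃' : α₃ ≤ 1 / 50) (hα₄ : 0 ≤ α₄)
    (hs₁ : 10 * C6 d * α₄ ≤ 1) (hs₂ : 3000 * ((d : ℝ) + 1) * L * α₄ ≤ 1) (hs₃ : C4G d L * (α₀ + α₃ + α₄) ≤ 1)
    (hs₄ : 1024 * ((d : ℝ) + 1) * ((d : ℝ) + 4) * L ^ 2 * α₀ ≤ 1) (hs₅ : 32 * ((d : ℝ) + 1) ^ 2 * C6 d * L ^ 2 * α₀ ≤ 1)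
    (hs₆ : 16 * d * C5' d * C6 d * (L : ℝ) ^ 2 * α₀ ≤ 1) :
    ∀ j ≤ k, ∀ z : SiteZ d, ‖((utilGZ L U₀ u' u₁ j z : 𝔸ˣ) : 𝔸) - 1‖ < 1 := by
  intro j hj z
  have hP := prop10_generalZ' hLs hs1 hd hV h52 h176 h177 hu₁ hη hk hα₀ hα₃ hα₃' hα₄ hs₁ hs₂ hs₃ hs₄ hs₅ hs₆
  have h : ‖((utilGZ L U₀ u' u₁ j z : 𝔸ˣ) : 𝔸) - 1‖ ≤ C6 d * α₄ := (hP j hj).2 z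
  exact lt_of_le_of_lt h (by linarith)

end Domain

/-! ## §5 The sentence of (208) -/

section Eq208

variable {𝔸 : Type*} [NormedRing 𝔸] [NormOneClass 𝔸] [NormedAlgebra ℂ 𝔸] [CompleteSpace 𝔸]
variable {E : Type*} [NormedAddCommGroup E] [NormedSpace ℂ E]

/-- **(208) AT A GENERAL BACKGROUND, parametric form** (p. 50: «It is obvious from the definition of the averaging operations that `ũ′ʲ`
are analytic functions of `λ`, and `Q′_j(u₁, λ) = (1/i) log ũ′ʲ, j ≦ k`, (208) are analytic functions of `λ` also»): for a
sitewise-analytic family of gauge functions `u′(t)` (`t` in any complex normed space `E`; e.g. `u′(t) = e^{λ(t)}`,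
`analyticAt_site_expGauge_family`) whose member `u′(t₀)` satisfies the hypotheses of Proposition 10 at a general background
(`B7Prop10General.prop10_general`: (176) `SiteBd (u′ t₀) α₄`, (177) `CovBondBd U₀ (u′ t₀) (α₄η)`, `u₁ ∈ Λ_k(U₀, α₃)`, the level
backgrounds `Ū₀ʲ`, `j < k`, in `U1` with «`α₀` replaced by `2α₀(Lʲη)²`», `L ≥ 2`, `0 ≤ η`, `Lᵏη ≤ 1`, explicit smallness), for every
`j ≤ k` and every site `z` of `Ω^{(j)}`: `t ↦ ũ′ʲ(z)[u′(t), u₁]` and `t ↦ log ũ′ʲ(z)[u′(t), u₁]` are analytic at `t₀`.  PROOF = print's: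
§§1–3 (composition of the averaging operations) with the disc conditions supplied by §4 (Proposition 10).
[cite: Balaban1985Averaging, (208) p.50, Proposition 10 p.50, (178)–(179) p.45] -/
theorem eq208Z_analyticAt {L s : ℕ} (hLs : L = 2 * s + 1) (hs1 : 1 ≤ s) (hd : 1 ≤ d) {U₀ : SiteZ d → Fin d → 𝔸ˣ} {k : ℕ} {u' : E → SiteZ d → 𝔸ˣ} {t₀ : E}
    (hu' : ∀ x, AnalyticAt ℂ (fun t => ((u' t x : 𝔸ˣ) : 𝔸)) t₀ ∧ AnalyticAt ℂ (fun t => (((u' t x)⁻¹ : 𝔸ˣ) : 𝔸)) t₀)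
    {u₁ : SiteZ d → 𝔸ˣ} {α₀ α₃ α₄ η : ℝ}
    (hV : ∀ j < k, ∀ (x : SiteZ d) (κ : Fin d), avgIterZ L U₀ j x κ ∈ U1 𝔸)
    (h52 : ∀ j < k, ∀ (x : SiteZ d) (κ μ : Fin d), κ ≠ μ →
      ‖((hol (avgIterZ L U₀ j) x (plaqWord κ μ) : 𝔸ˣ) : 𝔸) - 1‖ ≤ 2 * α₀ * ((L : ℝ) ^ j * η) ^ 2)
    (h176 : SiteBd (u' t₀) α₄) (h177 : CovBondBd U₀ (u' t₀) (α₄ * η)) (hu₁ : InLambdaZ L U₀ u₁ k α₃ η)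
    (hη : 0 ≤ η) (hk : (L : ℝ) ^ k * η ≤ 1) (hα₀ : 0 ≤ α₀) (hα₃ : 0 ≤ α₃) (hα₃' : α₃ ≤ 1 / 50) (hα₄ : 0 ≤ α₄)
    (hs₁ : 10 * C6 d * α₄ ≤ 1) (hs₂ : 3000 * ((d : ℝ) + 1) * L * α₄ ≤ 1) (hs₃ : C4G d L * (α₀ + α₃ + α₄) ≤ 1)
    (hs₄ : 1024 * ((d : ℝ) + 1) * ((d : ℝ) + 4) * L ^ 2 * α₀ ≤ 1) (hs₅ : 32 * ((d : ℝ) + 1) ^ 2 * C6 d * L ^ 2 * α₀ ≤ 1)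
    (hs₆ : 16 * d * C5' d * C6 d * (L : ℝ) ^ 2 * α₀ ≤ 1) :
    ∀ j ≤ k, ∀ z : SiteZ d,
      AnalyticAt ℂ (fun t => ((utilGZ L U₀ (u' t) u₁ j z : 𝔸ˣ) : 𝔸)) t₀ ∧
        AnalyticAt ℂ (fun t => mlog ((utilGZ L U₀ (u' t) u₁ j z : 𝔸ˣ) : 𝔸)) t₀ := by
  have hloop := prodLoopZ_lt_one hLs hs1 hd hV h52 h176 h177 hu₁ hη hk hα₀ hα₃ hα₃' hα₄ hs₁ hs₂ hs₃ hs₄ hs₅ hs₆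
  have hdisc := utilGZ_disc hLs hs1 hd hV h52 h176 h177 hu₁ hη hk hα₀ hα₃ hα₃' hα₄ hs₁ hs₂ hs₃ hs₄ hs₅ hs₆
  intro j hj z
  exact ⟨(analyticAt_utilGZ_family L U₀ hu' u₁ k hloop j hj z).1,
    analyticAt_mlog_utilGZ_family L U₀ hu' u₁ k hloop hj (hdisc j hj z)⟩

/-- **(208) AT A GENERAL BACKGROUND UNDER (52)** — `eq208_analyticAt` with its level hypotheses DISCHARGED by Proposition 2
(`B7Prop10General.levels_of52`): for `U₀` with values in an average-closed subgroup `G ⊂ U1` (e.g. `unitaryUnits 𝔸`) satisfying (52)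
`sup_p‖U₀(∂p) − 1‖ < α₀η²`, `η = L^{−k}`, `C₀α₀ ≤ ⅓`, `2α₀ ≤ c′₂`, a sitewise-analytic family `u′(t)` with `u′(t₀)` satisfying (176),
(177), and `u₁ ∈ Λ_k(U₀, α₃)`: `ũ′ʲ(z)` and `log ũ′ʲ(z)`, `j ≤ k`, are analytic at `t₀`.
[cite: Balaban1985Averaging, (208) p.50, Proposition 10 p.50, Proposition 2 p.26] -/
theorem eq208Z_analyticAt_of52 {L s : ℕ} (hLs : L = 2 * s + 1) (hs1 : 1 ≤ s) (hd : 1 ≤ d) {G : Subgroup 𝔸ˣ} (hG : AvgClosedZ d L G) {U₀ : SiteZ d → Fin d → 𝔸ˣ}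
    (hU : ∀ x κ, U₀ x κ ∈ G) {k : ℕ} {u' : E → SiteZ d → 𝔸ˣ} {t₀ : E}
    (hu' : ∀ x, AnalyticAt ℂ (fun t => ((u' t x : 𝔸ˣ) : 𝔸)) t₀ ∧ AnalyticAt ℂ (fun t => (((u' t x)⁻¹ : 𝔸ˣ) : 𝔸)) t₀)
    {u₁ : SiteZ d → 𝔸ˣ} {α₀ α₃ α₄ : ℝ}
    (hα : 0 < α₀) (hα3 : C0Z d * α₀ ≤ 1 / 3) (hα4 : 4 * α₀ ≤ c2' d L)
    (h52 : pdev U₀ < α₀ * (((L : ℝ) ^ k)⁻¹) ^ 2)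
    (h176 : SiteBd (u' t₀) α₄) (h177 : CovBondBd U₀ (u' t₀) (α₄ * ((L : ℝ) ^ k)⁻¹))
    (hu₁ : InLambdaZ L U₀ u₁ k α₃ (((L : ℝ) ^ k)⁻¹))
    (hα₃ : 0 ≤ α₃) (hα₃' : α₃ ≤ 1 / 50) (hα₄ : 0 ≤ α₄)
    (hs₁ : 10 * C6 d * α₄ ≤ 1) (hs₂ : 3000 * ((d : ℝ) + 1) * L * α₄ ≤ 1) (hs₃ : C4G d L * (α₀ + α₃ + α₄) ≤ 1)
    (hs₄ : 1024 * ((d : ℝ) + 1) * ((d : ℝ) + 4) * L ^ 2 * α₀ ≤ 1) (hs₅ : 32 * ((d : ℝ) + 1) ^ 2 * C6 d * L ^ 2 * α₀ ≤ 1)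
    (hs₆ : 16 * d * C5' d * C6 d * (L : ℝ) ^ 2 * α₀ ≤ 1) :
    ∀ j ≤ k, ∀ z : SiteZ d,
      AnalyticAt ℂ (fun t => ((utilGZ L U₀ (u' t) u₁ j z : 𝔸ˣ) : 𝔸)) t₀ ∧
        AnalyticAt ℂ (fun t => mlog ((utilGZ L U₀ (u' t) u₁ j z : 𝔸ˣ) : 𝔸)) t₀ := by
  have hL2 : 2 ≤ L := by omega
  obtain ⟨hV, hP⟩ := levels_of52Z hL2 hG hU k hα hα3 hα4 h52
  have hη : (0 : ℝ) ≤ ((L : ℝ) ^ k)⁻¹ := by positivity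
  have hk : (L : ℝ) ^ k * ((L : ℝ) ^ k)⁻¹ ≤ 1 := by rw [mul_inv_cancel₀ (by positivity)]
  exact eq208Z_analyticAt hLs hs1 hd hu' (fun j hj => hV j hj.le) (fun j hj => hP j hj.le) h176 h177 hu₁ hη hk hα.le hα₃ hα₃' hα₄
    hs₁ hs₂ hs₃ hs₄ hs₅ hs₆

/-- **(208) IN PRINT'S DATUM (207), AT A GENERAL BACKGROUND** (p. 50: «If we assume `|(D^η_{U₀}λ)(b)| < α₄, |λ(x)| < α₄, λ(x) ∈ 𝔤ᶜ,
α₄ sufficiently small`, (207) then … `ũ′ʲ` are analytic functions of `λ`, and `Q′_j(u₁, λ) = (1/i) log ũ′ʲ, j ≦ k`, (208) are analytic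
functions of `λ` also»).  HERE: `U₀` with values in an average-closed subgroup `G ⊂ U1` satisfying (52) `sup_p‖U₀(∂p) − 1‖ < α₀η²`,
`η = L^{−k}`; a sitewise-analytic family of data `λ(t) : ℤᵈ → 𝔸` (`t ∈ E`, any complex normed space) whose member `λ(t₀)` satisfies (207)
`‖R(U_{0,b})λ(b₊) − λ(b₋)‖ < α₄η` (`= η|(D^η_{U₀}λ)(b)|`), `‖λ(x)‖ < α₄`; `u′(t) := e^{λ(t)}`; `u₁ ∈ Λ_k(U₀, α₃)`; «α₄ sufficiently small»
= the smallness of Proposition 10 at `α₄ ↦ 4α₄` (all of it implied by the hypotheses of `B7Eq214General.eq214_general_of207`).  THEN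
for all `j ≤ k`, `z`: `t ↦ ũ′ʲ(z)` and `t ↦ log ũ′ʲ(z) = Q′_j(u₁, λ(t))(z)` are analytic at `t₀`.
[cite: Balaban1985Averaging, (207)–(208) p.50, Proposition 10 p.50, Proposition 2 p.26] -/
theorem eq208Z_analyticAt_of207 {L s : ℕ} (hLs : L = 2 * s + 1) (hs1 : 1 ≤ s) (hd : 1 ≤ d) {G : Subgroup 𝔸ˣ} (hG : AvgClosedZ d L G) {U₀ : SiteZ d → Fin d → 𝔸ˣ}
    (hU : ∀ x κ, U₀ x κ ∈ G) {k : ℕ} {lam : E → SiteZ d → 𝔸} {t₀ : E}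
    (hlam : ∀ x, AnalyticAt ℂ (fun t => lam t x) t₀)
    {u₁ : SiteZ d → 𝔸ˣ} {α₀ α₃ α₄ : ℝ}
    (hα : 0 < α₀) (hα3 : C0Z d * α₀ ≤ 1 / 3) (hα4 : 4 * α₀ ≤ c2' d L)
    (h52 : pdev U₀ < α₀ * (((L : ℝ) ^ k)⁻¹) ^ 2)
    (h207a : ∀ (x : SiteZ d) (κ : Fin d), ‖cj (U₀ x κ) (lam t₀ (x + e κ)) - lam t₀ x‖ < α₄ * ((L : ℝ) ^ k)⁻¹)
    (h207b : ∀ x : SiteZ d, ‖lam t₀ x‖ < α₄)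
    (hu₁ : InLambdaZ L U₀ u₁ k α₃ (((L : ℝ) ^ k)⁻¹))
    (hα₃ : 0 ≤ α₃) (hα₃' : α₃ ≤ 1 / 50)
    (hs₁ : 40 * C6 d * α₄ ≤ 1) (hs₂ : 12000 * ((d : ℝ) + 1) * L * α₄ ≤ 1) (hs₃ : C4G d L * (α₀ + α₃ + 4 * α₄) ≤ 1)
    (hs₄ : 1024 * ((d : ℝ) + 1) * ((d : ℝ) + 4) * L ^ 2 * α₀ ≤ 1) (hs₅ : 32 * ((d : ℝ) + 1) ^ 2 * C6 d * L ^ 2 * α₀ ≤ 1)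
    (hs₆ : 16 * d * C5' d * C6 d * (L : ℝ) ^ 2 * α₀ ≤ 1) :
    ∀ j ≤ k, ∀ z : SiteZ d,
      AnalyticAt ℂ (fun t => ((utilGZ L U₀ (fun x => expUnit (lam t x)) u₁ j z : 𝔸ˣ) : 𝔸)) t₀ ∧
        AnalyticAt ℂ (fun t => mlog ((utilGZ L U₀ (fun x => expUnit (lam t x)) u₁ j z : 𝔸ˣ) : 𝔸)) t₀ := by
  have hL1 : 1 ≤ L := by omega
  have hLr : (1 : ℝ) ≤ L := by exact_mod_cast hL1
  have hC6 : (2 : ℝ) ≤ C6 d := by unfold C6; linarith [one_le_C5 (d := d)]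
  have hα₄0 : 0 ≤ α₄ := le_of_lt (lt_of_le_of_lt (norm_nonneg _) (h207b 0))
  have hα₄' : α₄ ≤ 1 / 4 := by
    have h1 : 2 * α₄ ≤ C6 d * α₄ := mul_le_mul_of_nonneg_right hC6 hα₄0
    linarith
  have hη1 : ((L : ℝ) ^ k)⁻¹ ≤ 1 := inv_le_one_of_one_le₀ (one_le_pow₀ hLr)
  obtain ⟨h176, h177⟩ := siteBd_covBondBd_of207 hα₄' hη1 h207a h207b
  have hu' := fun x => analyticAt_site_expGauge_family lam hlam x
  have hs₁' : 10 * C6 d * (4 * α₄) ≤ 1 := by linarith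
  have hs₂' : 3000 * ((d : ℝ) + 1) * L * (4 * α₄) ≤ 1 := by linarith
  exact eq208Z_analyticAt_of52 hLs hs1 hd hG hU hu' hα hα3 hα4 h52 h176 h177 hu₁ hα₃ hα₃' (by positivity) hs₁' hs₂' hs₃ hs₄
    hs₅ hs₆

/-- **(208), THE PRINTED LETTER on `𝔸^S`: «Q′_j(u₁, λ) … are analytic functions of λ».**  For every finite set `S` of sites, the data
of `eq208_analyticAt_of207` (`U₀` `G`-valued with (52), `u₁ ∈ Λ_k(U₀, α₃)`, the displayed smallness), every `j ≤ k` and every site `z`: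
the function `𝔸^S → 𝔸`, `(λ_x)_{x∈S} ↦ Q′_j(u₁, λ)(z) = log ũ′ʲ(z)` [`λ = λ_x` on `S`, `λ = 0` off `S`: `insSite`; `u′ = e^{λ}`], is
analytic on a neighbourhood of every point of the (207)-domain `{λ : |(D^η_{U₀}λ)(b)| < α₄, |λ(x)| < α₄}`.
[cite: Balaban1985Averaging, (207)–(208) p.50] -/
theorem eq208Z_analyticOnNhd_ins (S : Finset (SiteZ d)) {L s : ℕ} (hLs : L = 2 * s + 1) (hs1 : 1 ≤ s) (hd : 1 ≤ d) {G : Subgroup 𝔸ˣ} (hG : AvgClosedZ d L G)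
    {U₀ : SiteZ d → Fin d → 𝔸ˣ} (hU : ∀ x κ, U₀ x κ ∈ G) {k : ℕ} {u₁ : SiteZ d → 𝔸ˣ} {α₀ α₃ α₄ : ℝ}
    (hα : 0 < α₀) (hα3 : C0Z d * α₀ ≤ 1 / 3) (hα4 : 4 * α₀ ≤ c2' d L)
    (h52 : pdev U₀ < α₀ * (((L : ℝ) ^ k)⁻¹) ^ 2)
    (hu₁ : InLambdaZ L U₀ u₁ k α₃ (((L : ℝ) ^ k)⁻¹))
    (hα₃ : 0 ≤ α₃) (hα₃' : α₃ ≤ 1 / 50)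
    (hs₁ : 40 * C6 d * α₄ ≤ 1) (hs₂ : 12000 * ((d : ℝ) + 1) * L * α₄ ≤ 1) (hs₃ : C4G d L * (α₀ + α₃ + 4 * α₄) ≤ 1)
    (hs₄ : 1024 * ((d : ℝ) + 1) * ((d : ℝ) + 4) * L ^ 2 * α₀ ≤ 1) (hs₅ : 32 * ((d : ℝ) + 1) ^ 2 * C6 d * L ^ 2 * α₀ ≤ 1)
    (hs₆ : 16 * d * C5' d * C6 d * (L : ℝ) ^ 2 * α₀ ≤ 1) {j : ℕ} (hj : j ≤ k) (z : SiteZ d) :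
    AnalyticOnNhd ℂ (fun a : S → 𝔸 => mlog ((utilGZ L U₀ (fun x => expUnit (insSite S a x)) u₁ j z : 𝔸ˣ) : 𝔸))
      {a | (∀ (x : SiteZ d) (κ : Fin d), ‖cj (U₀ x κ) (insSite S a (x + e κ)) - insSite S a x‖ < α₄ * ((L : ℝ) ^ k)⁻¹) ∧
        ∀ x : SiteZ d, ‖insSite S a x‖ < α₄} := by
  intro a ha
  exact (eq208Z_analyticAt_of207 hLs hs1 hd hG hU (lam := fun a' : S → 𝔸 => insSite S a') (fun x => analyticAt_insSite S x a) hα hα3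
    hα4 h52 ha.1 ha.2 hu₁ hα₃ hα₃' hs₁ hs₂ hs₃ hs₄ hs₅ hs₆ j hj z).2

/-- **«ũ′ʲ are analytic functions of λ», THE PRINTED LETTER on `𝔸^S`**: same data, the function `(λ_x)_{x∈S} ↦ ũ′ʲ(z)` is analytic on
a neighbourhood of every point of the (207)-domain. [cite: Balaban1985Averaging, (207)–(208) p.50, (178)–(179) p.45] -/
theorem utilGZ_analyticOnNhd_ins (S : Finset (SiteZ d)) {L s : ℕ} (hLs : L = 2 * s + 1) (hs1 : 1 ≤ s) (hd : 1 ≤ d) {G : Subgroup 𝔸ˣ} (hG : AvgClosedZ d L G)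
    {U₀ : SiteZ d → Fin d → 𝔸ˣ} (hU : ∀ x κ, U₀ x κ ∈ G) {k : ℕ} {u₁ : SiteZ d → 𝔸ˣ} {α₀ α₃ α₄ : ℝ}
    (hα : 0 < α₀) (hα3 : C0Z d * α₀ ≤ 1 / 3) (hα4 : 4 * α₀ ≤ c2' d L)
    (h52 : pdev U₀ < α₀ * (((L : ℝ) ^ k)⁻¹) ^ 2)
    (hu₁ : InLambdaZ L U₀ u₁ k α₃ (((L : ℝ) ^ k)⁻¹))
    (hα₃ : 0 ≤ α₃) (hα₃' : α₃ ≤ 1 / 50)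
    (hs₁ : 40 * C6 d * α₄ ≤ 1) (hs₂ : 12000 * ((d : ℝ) + 1) * L * α₄ ≤ 1) (hs₃ : C4G d L * (α₀ + α₃ + 4 * α₄) ≤ 1)
    (hs₄ : 1024 * ((d : ℝ) + 1) * ((d : ℝ) + 4) * L ^ 2 * α₀ ≤ 1) (hs₅ : 32 * ((d : ℝ) + 1) ^ 2 * C6 d * L ^ 2 * α₀ ≤ 1)
    (hs₆ : 16 * d * C5' d * C6 d * (L : ℝ) ^ 2 * α₀ ≤ 1) {j : ℕ} (hj : j ≤ k) (z : SiteZ d) :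
    AnalyticOnNhd ℂ (fun a : S → 𝔸 => ((utilGZ L U₀ (fun x => expUnit (insSite S a x)) u₁ j z : 𝔸ˣ) : 𝔸))
      {a | (∀ (x : SiteZ d) (κ : Fin d), ‖cj (U₀ x κ) (insSite S a (x + e κ)) - insSite S a x‖ < α₄ * ((L : ℝ) ^ k)⁻¹) ∧
        ∀ x : SiteZ d, ‖insSite S a x‖ < α₄} := by
  intro a ha
  exact (eq208Z_analyticAt_of207 hLs hs1 hd hG hU (lam := fun a' : S → 𝔸 => insSite S a') (fun x => analyticAt_insSite S x a) hα hα3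
    hα4 h52 ha.1 ha.2 hu₁ hα₃ hα₃' hs₁ hs₂ hs₃ hs₄ hs₅ hs₆ j hj z).1

/-- **(208) ALONG A COMPLEX LINE — the form [Balaban1985RegularSpaces] (1.124) p. 97 consumes** («⟨δC′(λ)/δλ, λ₀⟩ =
(2πi)⁻¹∮_{|τ|=r}dτ τ⁻²C′(λ + τλ₀)», `C′ = C′_j(u₁, ·)` of (213)): for fixed data `λ, λ₀ : ℤᵈ → 𝔸` and a point `τ₀ ∈ ℂ` with
`λ + τ₀λ₀` in the (207)-domain (the other data as in `eq208_analyticAt_of207`), `τ ↦ Q′_j(u₁, λ + τλ₀)(z) = log ũ′ʲ(z)[e^{λ + τλ₀}, u₁]`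
is analytic at `τ₀`, for all `j ≤ k`, `z`. [cite: Balaban1985Averaging, (208) p.50, (213) p.50] -/
theorem eq208Z_analyticAt_line {L s : ℕ} (hLs : L = 2 * s + 1) (hs1 : 1 ≤ s) (hd : 1 ≤ d) {G : Subgroup 𝔸ˣ} (hG : AvgClosedZ d L G) {U₀ : SiteZ d → Fin d → 𝔸ˣ}
    (hU : ∀ x κ, U₀ x κ ∈ G) {k : ℕ} (lam lam₀ : SiteZ d → 𝔸) {τ₀ : ℂ}
    {u₁ : SiteZ d → 𝔸ˣ} {α₀ α₃ α₄ : ℝ}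
    (hα : 0 < α₀) (hα3 : C0Z d * α₀ ≤ 1 / 3) (hα4 : 4 * α₀ ≤ c2' d L)
    (h52 : pdev U₀ < α₀ * (((L : ℝ) ^ k)⁻¹) ^ 2)
    (h207a : ∀ (x : SiteZ d) (κ : Fin d),
      ‖cj (U₀ x κ) (lam (x + e κ) + τ₀ • lam₀ (x + e κ)) - (lam x + τ₀ • lam₀ x)‖ < α₄ * ((L : ℝ) ^ k)⁻¹)
    (h207b : ∀ x : SiteZ d, ‖lam x + τ₀ • lam₀ x‖ < α₄)
    (hu₁ : InLambdaZ L U₀ u₁ k α₃ (((L : ℝ) ^ k)⁻¹))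
    (hα₃ : 0 ≤ α₃) (hα₃' : α₃ ≤ 1 / 50)
    (hs₁ : 40 * C6 d * α₄ ≤ 1) (hs₂ : 12000 * ((d : ℝ) + 1) * L * α₄ ≤ 1) (hs₃ : C4G d L * (α₀ + α₃ + 4 * α₄) ≤ 1)
    (hs₄ : 1024 * ((d : ℝ) + 1) * ((d : ℝ) + 4) * L ^ 2 * α₀ ≤ 1) (hs₅ : 32 * ((d : ℝ) + 1) ^ 2 * C6 d * L ^ 2 * α₀ ≤ 1)
    (hs₆ : 16 * d * C5' d * C6 d * (L : ℝ) ^ 2 * α₀ ≤ 1) :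
    ∀ j ≤ k, ∀ z : SiteZ d,
      AnalyticAt ℂ (fun τ : ℂ => mlog ((utilGZ L U₀ (fun x => expUnit (lam x + τ • lam₀ x)) u₁ j z : 𝔸ˣ) : 𝔸)) τ₀ := by
  have hlam : ∀ x, AnalyticAt ℂ (fun τ : ℂ => lam x + τ • lam₀ x) τ₀ := fun x =>
    analyticAt_const.add (analyticAt_id.smul analyticAt_const)
  intro j hj z
  exact (eq208Z_analyticAt_of207 hLs hs1 hd hG hU (lam := fun τ : ℂ => fun x => lam x + τ • lam₀ x) hlam hα hα3 hα4 h52 h207a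
    h207b hu₁ hα₃ hα₃' hs₁ hs₂ hs₃ hs₄ hs₅ hs₆ j hj z).2

end Eq208

end Literature.MathematicalPhysics.QuantumFieldTheory.Balaban1983to89.B7Eq208AnalyticRec
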